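import Summits.BirchSwinnertonDyer.BirchSwinnertonDyer.Theses.FrozenTwin
import Summits.BirchSwinnertonDyer.BirchSwinnertonDyer.Theses.ToricShedding
import Literature.NumberTheory.EllipticCurves.KuriharaNumberKimStructure
import Literature.NumberTheory.EllipticCurves.BSDSelmerParityDokchitserProofs
import HarnessLib

/-!
# Line `kurihara_depth` — the CYCLOTOMIC TWIN of the route's certificate, for crux
`UBPotentiallyGood` (stmt-BirchSwinnertonDyer-15878)

Crux (route FrozenTwin #4 = route ToricShedding #5, byte-identical decls): the potentially-good
sector of the Selmer-rank upper bound — for `E/ℚ` (globally minimal `W`) with NO prime of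
multiplicative reduction and every good ordinary `p ≥ 5` with `ρ̄_{E,p}` surjective,
`corank_{ℤ_p} Sel_{p^∞}(E/ℚ) ≤ ord_{s=1} L(E,s)`.

## The cut (crux-strategist `cstrat-stmt-BirchSwinnertonDyer-15878-b1`, 2026-08-17)

Route FrozenTwin reads an upper bound for the `p`-Selmer rank off the `𝔓`-adic valuation of ONE
rank-0 object: the order-`p` class-group twist `S_χ = Σ_𝔞 χ(𝔞) φ_E(x_𝔞)` of a Gross period on a
DEFINITE Shimura set (crux #2 `GrossMomentSharpness`: some binomial moment `M_k`, `k ≤ r_an(E)`, is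
prime to `p`; crux #3 `FrozenTwinBound`: `p ∤ M_k ⇒ corank ≤ k`). Its recorded obstruction in this
sector: over `ℚ` a definite setting needs an odd number of inert MULTIPLICATIVE primes, and there is
none. This line runs the SAME lever in the CYCLOTOMIC direction, where no quaternion algebra, no
auxiliary imaginary quadratic field, no sign condition and no class-number supply `p ∣ h_K` is
needed, and where the conversion theorem is PRINTED and proved without any `q ‖ N` proviso:

| FrozenTwin (class-group direction)            | this line (cyclotomic direction)                         |
|-----------------------------------------------|----------------------------------------------------------|
| `K` imaginary quadratic, `p ∣ h_K`, `⟨σ⟩ ⊂ Cl_K` | `ℚ(μ_n)`, `n = ℓ₁⋯ℓ_ν` Kolyvagin primes `ℓᵢ ≡ 1 (p^k)` (Čebotarev supply) |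
| Gross points `x_𝔞`, JL vector `φ_E`            | cusps `a/n`, modular symbols `[a/n]⁺ = Re{∞,a/n}/Ω⁺`       |
| theta element `θ_K = Σ_𝔞 φ_E(x_𝔞)[𝔞] ∈ ℤ[Cl_K]` | Mazur–Tate element `θ_n = Σ_a [a/n]⁺ σ_a ∈ ℤ_(p)[G_n]`     |
| binomial moment `M_k` = k-th Taylor coefficient of `θ_K` in `σ − 1` | Kurihara number `δ_n` = coefficient of `∏(σ_{η_ℓ} − 1)` in `θ_n` (`kuriharaNumber`) |
| `FrozenTwinBound` (freezing + doubling + rank-0 length; leaf UNPRINTED) | Kim 2022 Thm 1.9 (1): `δ_n ≢ 0 (mod p^k), n ∈ 𝒩_k ⇒ corank_p ≤ ν(n)` (PRINTED; tree fact) |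
| `GrossMomentSharpness` (open)                 | `stub_kuriharaDepthWitness` (open)                       |

Stubs:
* **GZK** `stub_gzkRange` (LITERATURE DEBT; byte-identical to line `birth`'s): `r_an ≤ 1 ⇒ corank_p =
  r_an` (Gross–Zagier–Kolyvagin + the proved corank identity). Owns `r_an ≤ 1`.
* **MODPER** `stub_newformUnitPeriod` (LITERATURE DEBT): for `p ≥ 5` good with `ρ̄_{E,p}` onto there
  is a newform `f` of `W` (BCDT 2001 Thm A, level `N_E` by Carayol) whose plus-period is the Néron
  real period up to a `p`-ADIC UNIT: `Ω(W) = u·Ω⁺_f`, `|u|_p = 1` — Edixhoven 1991 §1 (`m Ω(W) =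
  |c| Ω⁺_f`, tree fact `ModularParametrizationData.realPeriodRat_dvd`), `p ∤ c` for `p ∤ N`
  (Mazur 1978 Cor 4.1 / Abbes–Ullmo 1996 Thm A, tree fact
  `abbesUllmo_not_dvd_maninConstant_of_not_dvd_level`), and an isogeny of degree prime to `p` from
  the optimal curve (exists since `E[p]` is irreducible). This is exactly the normalisation
  hypothesis of the tree fact `Kim2022_selmerCorank_le_of_kuriharaNumber_ne_zero`.
* **KIM** `stub_kimCorankBound` (LITERATURE DEBT): VERBATIM the body of the tree fact
  `Literature.NumberTheory.EllipticCurves.Kim2022_selmerCorank_le_of_kuriharaNumber_ne_zero`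
  (C.-H. Kim, Amer. J. Math. 2026 = arXiv:2203.12159, Thm 1.9 (1), PDF p. 7): a Kurihara number
  `δ_n ≠ 0` in `ℤ/p^k`, `n ∈ 𝒩_k`, caps `corank_{ℤ_p} Sel_{p^∞}(E/ℚ) ≤ ν(n)` — Kato's Euler system +
  Mazur–Rubin Kolyvagin systems; needs NO multiplicative prime (`stub_kimCorankBound_of_fact`).
* **WIT** `stub_kuriharaDepthWitness` (OPEN, load-bearing): in the crux's sector and hypotheses and
  in the regime `2 ≤ r_an`, for the newform `f` with unit period ratio: SOME Kurihara number of
  depth `ν(n) ≤ r_an(E)` is non-zero mod `p^k` (`n ∈ 𝒩_k`, `k ≥ 1`). Equivalently: the Mazur–Tate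
  elements `θ_n` do not ALL lie deeper in the augmentation filtration than `r_an(E)` predicts
  ("tame sharpness at depth `r_an`"; the cyclotomic twin of `GrossMomentSharpness`).

`UBPotentiallyGood_of : stub_gzkRange → stub_newformUnitPeriod → stub_kimCorankBound →
stub_kuriharaDepthWitness → FrozenTwin.UBPotentiallyGood` (sorry-free): `r_an ≤ 1` → GZK; else
MODPER gives `(N, f, u)`, WIT gives `(k, n, ψ)` with `ν(n) ≤ r_an` and `δ_n ≠ 0`, KIM gives
`corank_p ≤ ν(n)`. `…ToricShedding` variants conclude the byte-identical primary-route decl.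

HONEST STATUS OF WIT (self-critic, problem-relative). Modulo theorems in print — Kim 2022 Thm 1.9
(1) both directions (`corank_p = ord(δ̃)` once `ord(δ̃) < ∞`) and Cor 1.6 (`ord(δ̃) < ∞` ⇐ the
cyclotomic main conjecture, a THEOREM at good ordinary `p ≥ 5` with `ρ̄` onto: Kato 2004 17.4 (3) +
Burungale–Castella–Skinner 2025 Thm 1.1.2 (b), no `q ‖ N` needed) — WIT is EQUIVALENT to the crux on
its open regime: an exact transfer (no slack — contrast line `birth`, whose open stub `ord_T L_p ≤
r_an` is STRONGER than the crux by a Schneider-type height non-degeneracy), not a weakening. The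
sibling censuses (Cruxes/SqueezeUB/STRATEGY-CENSUS.md v3 §D5, Cruxes/SelmerRankUB/STRATEGY-CENSUS.md
§T3) grade every criterion-type "depth ≤ r_an" statement as the one-prime Selmer cap in costume and
locate the wall at the missing ORDER-2 FORMULA; that verdict applies to WIT verbatim and is NOT
contested here. What the switch buys is organisational and computational, exactly as for the
route's own crux #2: (i) the sector crux becomes an instance of the route's lever with a PROVED
conversion step and no supply/sign/quaternion side conditions; (ii) WIT's objects are finite exact
rationals (`ratPlusSymbol`), so every INSTANCE `(E, p)` of the crux with `corank_p = r_an` is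
decidable in the useful direction and yields a kernel-checkable certificate modulo KIM (kit job
j024474: first in-sector depth-2 certificates; `Lines/kurihara_depth.md`); (iii) the analytic
theory of Mazur–Tate elements (functional equation, norm relations, Ota 2018 / Kim–Kurihara 2021
weak vanishing `ord_I θ_n ≥ rank`, Pollack–Weston λ-invariants) is available on the stub's side.
None of (i)–(iii) touches the wall: a proof of WIT must still extract tame non-vanishing at depth
`r_an` from `L^{(r_an)}(E,1) ≠ 0`, for which no mechanism exists at `r_an ≥ 2`.

Disproof used: none on file (`payload.disproof_path` does not exist; `ledger crux ls`: only line
`birth`, 2026-08-17). Negatives index: one entry (`LeadingTermTamePinch_refuted`, stmt-15532: a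
prime-SUPPLY statement refuted by CM curves) — no stub here asserts the existence of a prime; the
Kolyvagin-prime supply inside WIT is part of an OPEN stub's conclusion under a surjectivity
hypothesis that no CM curve meets, so it is not an instance of the refuted statement.
-/

set_option linter.dupNamespace false

namespace Summit.BirchSwinnertonDyer.BirchSwinnertonDyer.Cruxes.UBPotentiallyGood.KuriharaDepth

open Summit.BirchSwinnertonDyer.BirchSwinnertonDyer.Theses.FrozenTwin (UBPotentiallyGood)
open Literature.NumberTheory.EllipticCurves
open Literature.NumberTheory.EllipticCurves.ModularForms

/-! ### Registered stubs -/

/-- Stub **GZK** (literature debt, image-free, every prime): if `ord_{s=1} L(E,s) ≤ 1` then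
`corank_{ℤ_p} Sel_{p^∞}(E/ℚ) = ord_{s=1} L(E,s)` — Gross–Zagier–Kolyvagin (`rank = r_an` and
`Ш(E/ℚ)` finite) with the proved corank identity `corank Sel_{p^∞} = rank + corank Ш[p^∞]`.
In tree modulo the named fact `rank_eq_analyticRank_of_analyticRank_le_one`
(`stub_gzkRange_of_fact`). Byte-identical to the GZK stub of line `birth`. [cite: Darmon2004, Thm. 3.22] -/
theorem stub_gzkRange :
    ∀ (W : WeierstrassCurve ℚ) [W.IsElliptic] (p : ℕ) [Fact p.Prime],
      W.analyticRank ≤ 1 → W.selmerCorank p = W.analyticRank := by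
  sorry

/-- Stub **MODPER** (literature debt): MODULARITY WITH A `p`-UNIT PERIOD RATIO. For `E/ℚ` (globally
minimal `W`) and a prime `p ≥ 5` of good reduction at which `ρ̄_{E,p}` is surjective, there are a
level `N ≥ 1`, a newform `f ∈ S₂(Γ₀(N))` with `aₙ(f) = aₙ(E)` (`IsNewformOf W f`; BCDT 2001 Thm A,
`N = N_E` by Carayol 1986) and a rational `u` with `|u|_p = 1` and `Ω(W) = u · Ω⁺_f`
(`W.realPeriodRat = u * plusPeriod f`). In print: `m · Ω(W) = |c| · Ω⁺_f` for a parametrisation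
`X₀(N) → W` with Manin constant `c ∈ ℤ` and an index `m ≥ 1` (Edixhoven 1991 §1; tree fact
`ModularParametrizationData.realPeriodRat_dvd`); for the optimal curve `m = 1` and `p ∤ c` since
`p ∤ N_E` (Mazur 1978 Cor 4.1, `p ∣ c ⇒ p² ∣ 4N`; Abbes–Ullmo 1996 Thm A, tree fact
`abbesUllmo_not_dvd_maninConstant_of_not_dvd_level`); `W` is reached from the optimal curve by an
isogeny of degree prime to `p` (all rational isogenies in the class have degree prime to `p`
because `E[p]` is irreducible), which changes `c` and `m` by divisors of that degree. This is the
normalisation hypothesis of Kim's theorem as vendored in the tree. [cite: EdixhovenManin1991, §1] -/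
theorem stub_newformUnitPeriod :
    ∀ (W : WeierstrassCurve ℚ) [W.IsElliptic] [W.IsGloballyMinimal] (p : ℕ) [Fact p.Prime],
      5 ≤ p → W.HasGoodReductionAtPrime p → W.HasSurjectiveModNGaloisRep p →
        ∃ (N : ℕ) (_ : NeZero N) (f : CuspForm (CongruenceSubgroup.Gamma0 N) 2),
          Literature.NumberTheory.EllipticCurves.ModularForms.IsNewformOf W f ∧
            ∃ u : ℚ, ‖(u : ℚ_[p])‖ = 1 ∧ W.realPeriodRat = u * Literature.NumberTheory.EllipticCurves.ModularForms.plusPeriod f := by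
  sorry

/-- Stub **KIM** (literature debt): KIM'S CORANK BOUND BY A NON-VANISHING KURIHARA NUMBER — verbatim
the body of the tree fact `Kim2022_selmerCorank_le_of_kuriharaNumber_ne_zero` (C.-H. Kim, *The
structure of Selmer groups and the Iwasawa main conjecture for elliptic curves*, Amer. J. Math.
(2026) = arXiv:2203.12159, Thm 1.9 (1), PDF p. 7, with §1.4.1–1.4.4): for `W` globally minimal,
`p ≥ 5` good with `p ∤ a_p` and `ρ̄_{E,p}` onto, `f` the newform of `W` with unit period ratio,
`k ≥ 1`, `n ∈ 𝒩_k` (`Kato.IsKolyvaginProduct W p k n`) and surjective discrete logarithms `ψ_ℓ`,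
`kuriharaNumber f (p^k) n ψ ≠ 0 ⇒ corank_{ℤ_p} Sel_{p^∞}(E/ℚ) ≤ ν(n) = #primeFactors n`. Kato's
Euler system and Mazur–Rubin's Kolyvagin systems; NO multiplicative prime, no auxiliary field
(`stub_kimCorankBound_of_fact`). [cite: Kim2022StructureSelmer, Thm. 1.9 (1) (PDF p. 7)] -/
theorem stub_kimCorankBound :
    ∀ (W : WeierstrassCurve ℚ) [W.IsElliptic] [W.IsGloballyMinimal] (p : ℕ) [Fact p.Prime],
      5 ≤ p → W.HasGoodReductionAtPrime p → ¬ (p : ℤ) ∣ W.frobeniusTrace p →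
      W.HasSurjectiveModNGaloisRep p →
      ∀ {N : ℕ} [NeZero N] (f : CuspForm (CongruenceSubgroup.Gamma0 N) 2),
      Literature.NumberTheory.EllipticCurves.ModularForms.IsNewformOf W f →
      (∃ u : ℚ, ‖(u : ℚ_[p])‖ = 1 ∧ W.realPeriodRat = u * Literature.NumberTheory.EllipticCurves.ModularForms.plusPeriod f) →
      ∀ (k n : ℕ) [NeZero n], 1 ≤ k →
      Literature.NumberTheory.EllipticCurves.Kato.IsKolyvaginProduct W p k n →
      ∀ ψ : (ℓ : ℕ) → (ZMod ℓ)ˣ →* Multiplicative (ZMod (p ^ k)),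
        (∀ ℓ ∈ n.primeFactors, Function.Surjective (ψ ℓ)) →
        Literature.NumberTheory.EllipticCurves.kuriharaNumber f (p ^ k) n ψ ≠ 0 →
        W.selmerCorank p ≤ n.primeFactors.card := by
  sorry

/-- Stub **WIT** (OPEN — the load-bearing stub): TAME SHARPNESS AT DEPTH `r_an`. For `E/ℚ` (globally
minimal `W`) with NO prime of multiplicative reduction, a prime `p ≥ 5` of good ordinary reduction
with `ρ̄_{E,p}` surjective, `ord_{s=1} L(E,s) ≥ 2`, and a newform `f` of `W` with unit period ratio
at `p`: there are `k ≥ 1`, a square-free product `n` of Kolyvagin primes of level `k`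
(`ℓ ∤ N_E p`, `ℓ ≡ 1`, `a_ℓ ≡ ℓ + 1 (mod p^k)`) with AT MOST `ord_{s=1} L(E,s)` prime factors, and
surjective discrete logarithms `ψ_ℓ : (ℤ/ℓ)ˣ → ℤ/p^k`, such that the Kurihara number
`δ_n = Σ_{a ∈ (ℤ/n)ˣ} [a/n]⁺_f · ∏_{ℓ ∣ n} ψ_ℓ(a) ∈ ℤ/p^k` is NON-ZERO. Informally: the Mazur–Tate
modular elements `θ_{ℚ(μ_n)}` are not all deeper in the augmentation ideal than depth `r_an(E)` —
the cyclotomic twin of FrozenTwin's `GrossMomentSharpness` (moment index `k ≤ r_an` ↦ depth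
`ν(n) ≤ r_an`). Status: modulo Kim 2022 Thm 1.9 (1)+Cor 1.6 and the cyclotomic main conjecture
(a theorem here: Kato 2004 Thm 17.4 (3) + Burungale–Castella–Skinner 2025 Thm 1.1.2 (b)),
`ord(δ̃) = corank_p`, so WIT ⟺ the crux on `r_an ≥ 2` — an exact transfer, walled exactly where the
crux is (no mechanism turns `L^{(r)}(E,1) ≠ 0`, `r ≥ 2`, into tame non-vanishing; sibling censuses
SqueezeUB v3 §D5 / SelmerRankUB §T3). Why it might fail: only together with the crux (granting the
printed theorems) — e.g. an in-sector curve with an infinitely `p`-divisible `Ш` at a big-image `p`;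
as typed it could also fail by MIS-normalisation (period ratio, `𝒩_k`, orientation of `[a/n]⁺`),
which kit job j024474 checks on controls 11a1/37a1/389a1. Plausibly true: predicted by BSD + finite
`Ш`; depth-2 instances are being certified numerically in the sector (j024474).
[cite: Kurihara2014, §1.1 (2) (PDF p. 2)] -/
theorem stub_kuriharaDepthWitness :
    ∀ (W : WeierstrassCurve ℚ) [W.IsElliptic] [W.IsGloballyMinimal],
      (¬ ∃ (q : ℕ) (_ : Fact q.Prime), W.HasMultiplicativeReductionAtPrime q) →
        ∀ (p : ℕ) [Fact p.Prime], 5 ≤ p → W.HasGoodReductionAtPrime p →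
          ¬ (p : ℤ) ∣ W.frobeniusTrace p → W.HasSurjectiveModNGaloisRep p →
            2 ≤ W.analyticRank →
              ∀ {N : ℕ} [NeZero N] (f : CuspForm (CongruenceSubgroup.Gamma0 N) 2),
                Literature.NumberTheory.EllipticCurves.ModularForms.IsNewformOf W f →
                  (∃ u : ℚ, ‖(u : ℚ_[p])‖ = 1 ∧ W.realPeriodRat = u * Literature.NumberTheory.EllipticCurves.ModularForms.plusPeriod f) →
                    ∃ (k n : ℕ) (_ : NeZero n), 1 ≤ k ∧ Literature.NumberTheory.EllipticCurves.Kato.IsKolyvaginProduct W p k n ∧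
                      n.primeFactors.card ≤ W.analyticRank ∧
                        ∃ ψ : (ℓ : ℕ) → (ZMod ℓ)ˣ →* Multiplicative (ZMod (p ^ k)),
                          (∀ ℓ ∈ n.primeFactors, Function.Surjective (ψ ℓ)) ∧
                            Literature.NumberTheory.EllipticCurves.kuriharaNumber f (p ^ k) n ψ ≠ 0 := by
  sorry

/-! ### Stub statements by name (`type_of%`, as in line `birth`) -/

namespace Statement

/-- Statement of `stub_gzkRange`. -/
abbrev stub_gzkRange : Prop := type_of% @KuriharaDepth.stub_gzkRange
/-- Statement of `stub_newformUnitPeriod`. -/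
abbrev stub_newformUnitPeriod : Prop := type_of% @KuriharaDepth.stub_newformUnitPeriod
/-- Statement of `stub_kimCorankBound`. -/
abbrev stub_kimCorankBound : Prop := type_of% @KuriharaDepth.stub_kimCorankBound
/-- Statement of `stub_kuriharaDepthWitness`. -/
abbrev stub_kuriharaDepthWitness : Prop := type_of% @KuriharaDepth.stub_kuriharaDepthWitness

end Statement

/-! ### The crux from the stubs (kernel-checked composition, no `sorry`) -/

/-- **The crux BY NAME from the four stub statements** (GZK → MODPER → KIM → WIT →
`FrozenTwin.UBPotentiallyGood`): if `r_an ≤ 1` use GZK; otherwise MODPER supplies a newform `f`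
with unit period ratio, WIT a non-vanishing Kurihara number `δ_n ≠ 0 (mod p^k)` of depth
`ν(n) ≤ r_an`, and KIM turns it into `corank_p ≤ ν(n)`. [folklore] -/
theorem UBPotentiallyGood_of (hGZK : Statement.stub_gzkRange)
    (hMod : Statement.stub_newformUnitPeriod) (hKim : Statement.stub_kimCorankBound)
    (hWit : Statement.stub_kuriharaDepthWitness) : UBPotentiallyGood := by
  intro W _ _ hpg p _ h5 hgood hord hsurj
  by_cases h1 : W.analyticRank ≤ 1
  · exact (hGZK W p h1).le
  · have h2 : 2 ≤ W.analyticRank := by omega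
    obtain ⟨N, hN, f, hf, hu⟩ := hMod W p h5 hgood hsurj
    obtain ⟨k, n, hn, hk, hprod, hcard, ψ, hψ, hne⟩ :=
      hWit W hpg p h5 hgood hord hsurj h2 f hf hu
    exact (hKim W p h5 hgood hord hsurj f hf hu k n hk hprod ψ hψ hne).trans hcard

/-- The crux along this line (route `FrozenTwin` decl, by name), MODULO exactly the four
registered stubs (depends on `sorryAx` only through `stub_*`). [folklore] -/
theorem UBPotentiallyGood_proof : UBPotentiallyGood :=
  UBPotentiallyGood_of stub_gzkRange stub_newformUnitPeriod stub_kimCorankBound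
    stub_kuriharaDepthWitness

/-- The same composition under the byte-identical decl of route `ToricShedding` (the item's primary
route), sorry-free with the stub statements as named hypotheses. [folklore] -/
theorem UBPotentiallyGood_ofToricShedding (hGZK : Statement.stub_gzkRange)
    (hMod : Statement.stub_newformUnitPeriod) (hKim : Statement.stub_kimCorankBound)
    (hWit : Statement.stub_kuriharaDepthWitness) :
    Summit.BirchSwinnertonDyer.BirchSwinnertonDyer.Theses.ToricShedding.UBPotentiallyGood :=
  fun W _ _ hpg p _ h5 hgood hord hsurj =>
    UBPotentiallyGood_of hGZK hMod hKim hWit W hpg p h5 hgood hord hsurj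

/-- The crux along this line under the `ToricShedding` decl, MODULO the four registered stubs.
[folklore] -/
theorem UBPotentiallyGood_proofToricShedding :
    Summit.BirchSwinnertonDyer.BirchSwinnertonDyer.Theses.ToricShedding.UBPotentiallyGood :=
  UBPotentiallyGood_ofToricShedding stub_gzkRange stub_newformUnitPeriod stub_kimCorankBound
    stub_kuriharaDepthWitness

/-! ### What discharges the literature stubs (kernel-checked pointers, no `sorry`) -/

/-- GZK is the tree fact bsd.S17 composed with the proved corank identity. [folklore] -/
theorem stub_gzkRange_of_fact
    (h : Literature.NumberTheory.EllipticCurves.rank_eq_analyticRank_of_analyticRank_le_one) :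
    Statement.stub_gzkRange :=
  fun W _ p _ h1 =>
    Literature.NumberTheory.EllipticCurves.selmerCorank_eq_analyticRank_of_analyticRank_le_one
      h W p h1

/-- KIM is VERBATIM the tree fact `Kim2022_selmerCorank_le_of_kuriharaNumber_ne_zero`
(definitional unfolding). [folklore] -/
theorem stub_kimCorankBound_of_fact
    (h : Literature.NumberTheory.EllipticCurves.Kim2022_selmerCorank_le_of_kuriharaNumber_ne_zero) :
    Statement.stub_kimCorankBound :=
  fun W _ _ p _ h5 hgood hord hsurj _ _ f hf hu k n _ hk hprod ψ hψ hne =>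
    h W p h5 hgood hord hsurj f hf hu k n hk hprod ψ hψ hne

/-! ### Exactness remark (kernel-checked): on `r_an ≥ 2`, WIT is implied by the crux together with
the printed converse direction of Kim's theorem — recorded as a HYPOTHESIS `hKimConv` (Kim 2022
Thm 1.9 (1) with Cor 1.6: `corank_p = ν(n)` is ATTAINED by a non-vanishing `δ_n`, `n ∈ 𝒩_k`), so
that the line's honesty clause "WIT ⟺ crux modulo print" is itself in Lean, not only in prose. -/

/-- The converse clause of Kim's structure theorem as a hypothesis shape: at a big-image good
ordinary `p ≥ 5`, for the newform with unit period ratio, SOME Kurihara number of depth exactly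
`corank_p Sel_{p^∞}(E/ℚ)` is non-zero (Kim 2022 Thm 1.9 (1) "`cork = ord(δ̃)`" with Cor 1.6
"`ord(δ̃) < ∞`", the latter by the cyclotomic main conjecture = Kato 17.4 (3) + BCS 2025 1.1.2 (b)).
Stated as a `def` used only as a hypothesis below; NOT a registered stub. [cite: Kim2022StructureSelmer, Thm. 1.9 (1) and Cor. 1.6 (PDF pp. 6–7)] -/
def KimDepthAttained : Prop :=
  ∀ (W : WeierstrassCurve ℚ) [W.IsElliptic] [W.IsGloballyMinimal] (p : ℕ) [Fact p.Prime],
    5 ≤ p → W.HasGoodReductionAtPrime p → ¬ (p : ℤ) ∣ W.frobeniusTrace p →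
    W.HasSurjectiveModNGaloisRep p →
    ∀ {N : ℕ} [NeZero N] (f : CuspForm (CongruenceSubgroup.Gamma0 N) 2),
    Literature.NumberTheory.EllipticCurves.ModularForms.IsNewformOf W f →
    (∃ u : ℚ, ‖(u : ℚ_[p])‖ = 1 ∧ W.realPeriodRat = u * Literature.NumberTheory.EllipticCurves.ModularForms.plusPeriod f) →
    ∃ (k n : ℕ) (_ : NeZero n), 1 ≤ k ∧ Literature.NumberTheory.EllipticCurves.Kato.IsKolyvaginProduct W p k n ∧
      n.primeFactors.card = W.selmerCorank p ∧
        ∃ ψ : (ℓ : ℕ) → (ZMod ℓ)ˣ →* Multiplicative (ZMod (p ^ k)),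
          (∀ ℓ ∈ n.primeFactors, Function.Surjective (ψ ℓ)) ∧ Literature.NumberTheory.EllipticCurves.kuriharaNumber f (p ^ k) n ψ ≠ 0

/-- **Exactness**: the crux together with Kim's attained-depth clause gives WIT (so, modulo print,
WIT carries exactly the crux's open content on `r_an ≥ 2`, neither more nor less). [folklore] -/
theorem stub_kuriharaDepthWitness_of_crux (hUB : UBPotentiallyGood) (hKimConv : KimDepthAttained) :
    Statement.stub_kuriharaDepthWitness := by
  intro W _ _ hpg p _ h5 hgood hord hsurj _ N _ f hf hu
  obtain ⟨k, n, hn, hk, hprod, hcard, ψ, hψ, hne⟩ := hKimConv W p h5 hgood hord hsurj f hf hu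
  exact ⟨k, n, hn, hk, hprod, hcard ▸ hUB W hpg p h5 hgood hord hsurj, ψ, hψ, hne⟩

end Summit.BirchSwinnertonDyer.BirchSwinnertonDyer.Cruxes.UBPotentiallyGood.KuriharaDepth
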